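import Summits.PneNP.PneNP.Theorems.RegularResolutionRung.Negative.EmptyGraphLines

/-!
# `RegularResolutionRung` (stmt-PneNP-9818) is FALSE on either side alone

Negative lemmas for the crux `RamseyUncertifiable.RegularResolutionRung` (load-bearing analysis by
the cdisprove seat; copy of the crux work file `Cruxes/RegularResolutionRung/Disproof.lean`).

The crux asks `n^{ε log₂ n} ≤ max |π₁| |π₂|` for regular resolution refutations `π₁` of the unary
clique formula `Clique(G, ⌈2log₂ n⌉)` and `π₂` of `Clique(Ḡ, ⌈2log₂ n⌉)`, for EVERY graph `G` on
`n ≥ n₀` vertices. We prove that each ONE-SIDED version is false: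

* `exists_short_regular_refutation`: for the empty graph on `n ≥ 1` vertices and every `k ≥ 2`,
  `Clique(∅ₙ, k)` (the route's `cnf` with `adj ≡ false`) has an explicit REGULAR resolution
  refutation with `2n² + n + 2` lines (`EmptyGraphLines.lean`); validity
  (`refutation_isResDerivation`) and regularity (`refutation_isRegular`, rank = pivot + 1 strictly
  decreasing along DAG paths) are fully checked here.
* `regularResolutionRung_false_without_complement`: the crux with `π₂` dropped is false
  (`G = ⊥`, `n = 2^m`, `2n²+n+2 < n^{ε log₂ n}` eventually, `key_bound`).
* `regularResolutionRung_false_without_graph`: the crux with `π₁` dropped is false (`G = ⊤`).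
* `restated_of_withoutComplement` / `restated_of_withoutGraph`: both are strengthenings, and
  `regularResolutionRung_iff_restated : crux ↔ Restated` is `Iff.rfl` (read-back through
  `cliqueCNF`).

Hence any proof of the crux must use that BOTH `G` and `Ḡ` are `⌈2log₂n⌉`-clique-free, i.e. that
`G` is a genuine Ramsey graph — the `max` is where Ramsey's theorem enters (ABdRLNR21 §9 poses the
symmetric question as open; LPRT13 Thm 4 is the tree-like case). [folklore]
-/

namespace Summit.PneNP.PneNP.Theorems.RegularResolutionRung.Negative

open Literature.Computability.MetaComplexity Literature.Computability.Complexity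

section validity
variable {n : ℕ}

/-- The block-member clause of block `i < k` is an axiom of `cliqueCNF`. -/
theorem block_mem (k i : ℕ) (hi : i < k) (adj : Fin n → Fin n → Bool) :
    ((List.finRange n).map fun v => (i * n + (v : ℕ), true)) ∈ cliqueCNF n k adj := by
  unfold cliqueCNF
  refine List.mem_append.2 (Or.inl (List.mem_append.2 (Or.inl ?_)))
  exact List.mem_map.2 ⟨i, List.mem_range.2 hi, rfl⟩

/-- The edge clause for `i ≠ j` and a non-adjacent (or equal) pair is an axiom of `cliqueCNF`. -/
theorem edge_mem (k i j : ℕ) (hi : i < k) (hj : j < k) (hij : i ≠ j) (adj : Fin n → Fin n → Bool)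
    (u v : Fin n) (huv : adj u v = false) :
    [(i * n + (u : ℕ), false), (j * n + (v : ℕ), false)] ∈ cliqueCNF n k adj := by
  unfold cliqueCNF
  refine List.mem_append.2 (Or.inr ?_)
  refine List.mem_flatMap.2 ⟨i, List.mem_range.2 hi, List.mem_flatMap.2 ⟨j, List.mem_range.2 hj,
    List.mem_flatMap.2 ⟨u, List.mem_finRange u, List.mem_flatMap.2 ⟨v, List.mem_finRange v, ?_⟩⟩⟩⟩
  rw [if_pos ⟨hij, huv⟩]
  exact List.mem_singleton.2 rfl

/-- The block-0 member clause as a finset. -/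
theorem toFinset_block0 : ((List.finRange n).map fun v => (0 * n + (v : ℕ), true)).toFinset = pos0 0 n := by
  ext ⟨a, b⟩
  rw [List.mem_toFinset, mem_pos0]
  simp [Fin.exists_iff]

/-- The block-1 member clause as a finset. -/
theorem toFinset_block1 : ((List.finRange n).map fun v => (1 * n + (v : ℕ), true)).toFinset = pos1 0 n := by
  ext ⟨a, b⟩
  rw [List.mem_toFinset, mem_pos1]
  simp [Fin.exists_iff]
  constructor
  · rintro ⟨v, hv, rfl, rfl⟩; exact ⟨by omega, by omega, rfl⟩
  · rintro ⟨h1, h2, rfl⟩; exact ⟨a - n, by omega, by omega, rfl⟩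

/-- An edge axiom as a finset. -/
theorem toFinset_edge (t s : ℕ) : [(0 * n + t, false), (1 * n + s, false)].toFinset = clE n t s := by
  simp [clE]

/-- Clauses of `φ` give members of `φ.clauseFinsets`. -/
theorem mem_clauseFinsets {φ : CNF ℕ} {c : Clause ℕ} (hc : c ∈ φ) : c.toFinset ∈ φ.clauseFinsets :=
  List.mem_map.2 ⟨c, hc, rfl⟩

/-! ### Validity, refutation, regularity -/

/-- VALIDITY: every line of `refutation n` is justified (empty graph, `n ≥ 1`, `k ≥ 2`). -/
theorem refutation_isResDerivation {k : ℕ} (hn : 1 ≤ n) (hk : 2 ≤ k) :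
    IsResDerivation (cliqueCNF n k fun _ _ => false) (refutation n) := by
  refine isResDerivation_map_range ?_ ?_ ?_
  · -- initial lines
    intro a ha hrule
    rcases region_cases hn ha with rfl | rfl | ⟨s, t, hs, ht, rfl⟩ | ⟨s, t, hs, ht, rfl⟩ | ⟨s, hs, rfl⟩
    · rw [line_zero, ← toFinset_block1]
      exact mem_clauseFinsets (block_mem k 1 (by omega) _)
    · rw [line_one, ← toFinset_block0]
      exact mem_clauseFinsets (block_mem k 0 (by omega) _)
    · rw [lineE_spec hs ht, ← toFinset_edge]
      exact mem_clauseFinsets (edge_mem k 0 1 (by omega) (by omega) (by omega) _ ⟨t, ht⟩ ⟨s, hs⟩ rfl)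
    · rw [lineR_spec hs ht] at hrule; cases hrule
    · rw [lineT_spec s] at hrule; cases hrule
  · -- resolution lines
    intro a ha i j v hrule
    rcases region_cases hn ha with rfl | rfl | ⟨s, t, hs, ht, rfl⟩ | ⟨s, t, hs, ht, rfl⟩ | ⟨s, hs, rfl⟩
    · rw [line_zero] at hrule; cases hrule
    · rw [line_one] at hrule; cases hrule
    · rw [lineE_spec hs ht] at hrule; cases hrule
    · -- R-line (s,t): resolve on x_{0,t}
      have hsnt := idxR_lt hs ht
      rw [lineR_spec hs ht] at hrule ⊢
      simp only [ResRule.resolve.injEq] at hrule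
      obtain ⟨rfl, rfl, rfl⟩ := hrule
      rw [lineE_spec hs ht]
      rcases Nat.eq_zero_or_pos t with rfl | htpos
      · simp only [if_true, line_one]
        refine ⟨by omega, by omega, ?_, ?_, ?_⟩
        · exact mem_pos0.2 ⟨le_rfl, hn, rfl⟩
        · simp [clE]
        · rw [pos0_erase, clE_erase hn]; rfl
      · rw [if_neg (by omega)]
        obtain ⟨t', rfl⟩ : ∃ t', t = t' + 1 := ⟨t - 1, by omega⟩
        have e : 2 + n * n + (s * n + (t' + 1)) - 1 = 2 + n * n + (s * n + t') := by omega
        rw [e, lineR_spec hs (by omega)]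
        refine ⟨by omega, by omega, ?_, ?_, ?_⟩
        · exact Finset.mem_union_left _ (mem_pos0.2 ⟨le_rfl, ht, rfl⟩)
        · simp [clE]
        · show clR n s (t' + 1) = (clR n s t').erase (t' + 1, true) ∪ (clE n (t' + 1) s).erase (t' + 1, false)
          rw [clR, clR, clR_erase, clE_erase ht, Finset.union_assoc, Finset.union_idempotent]
    · -- T-line s: resolve on x_{1,s}
      rw [lineT_spec s] at hrule ⊢
      simp only [ResRule.resolve.injEq] at hrule
      obtain ⟨rfl, rfl, rfl⟩ := hrule
      have hsn := idxR_lt hs (show n - 1 < n by omega)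
      rw [lineR_spec hs (show n - 1 < n by omega)]
      have hC : (line n (if s = 0 then 0 else 2 + 2 * (n * n) + s - 1)).clause = pos1 s n := by
        rcases Nat.eq_zero_or_pos s with rfl | hspos
        · simp [line_zero]
        · rw [if_neg (by omega)]
          have e : 2 + 2 * (n * n) + s - 1 = 2 + 2 * (n * n) + (s - 1) := by omega
          rw [e, lineT_spec (s - 1), Nat.sub_add_cancel hspos]
      refine ⟨by split_ifs <;> omega, by omega, ?_, ?_, ?_⟩
      · rw [hC]; exact mem_pos1.2 ⟨le_rfl, by omega, rfl⟩
      · exact Finset.mem_union_right _ (Finset.mem_singleton_self _)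
      · rw [hC, pos1_erase, clR, Nat.sub_add_cancel hn, pos0_self, Finset.empty_union,
          Finset.erase_singleton, Finset.union_empty]
  · -- no weakening lines
    intro a ha i hrule
    rcases region_cases hn ha with rfl | rfl | ⟨s, t, hs, ht, rfl⟩ | ⟨s, t, hs, ht, rfl⟩ | ⟨s, hs, rfl⟩
    · rw [line_zero] at hrule; cases hrule
    · rw [line_one] at hrule; cases hrule
    · rw [lineE_spec hs ht] at hrule; cases hrule
    · rw [lineR_spec hs ht] at hrule; cases hrule
    · rw [lineT_spec s] at hrule; cases hrule

/-- `refutation n` refutes `Clique(∅ₙ, k)`. -/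
theorem refutation_isResRefutation {k : ℕ} (hn : 1 ≤ n) (hk : 2 ≤ k) :
    IsResRefutation (cliqueCNF n k fun _ _ => false) (refutation n) := by
  refine ⟨refutation_isResDerivation hn hk, line n (2 + 2 * (n * n) + (n - 1)),
    List.mem_map.2 ⟨_, List.mem_range.2 (by omega), rfl⟩, ?_⟩
  rw [lineT_spec (n - 1), Nat.sub_add_cancel hn]
  exact pos1_self n

/-- rank of a line: pivot + 1 for resolution lines, 0 otherwise -/
def rank (n a : ℕ) : ℕ := ((line n a).rule.pivot?.map (· + 1)).getD 0

/-- REGULARITY of `refutation n`, via the rank `pivot + 1`: along every DAG path the pivots are `n+s > … ` (outer chain) followed by `t > t-1 > …` (one inner chain), all `< n + s`. -/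
theorem refutation_isRegular (hn : 1 ≤ n) : IsRegular (refutation n) := by
  refine isRegular_of_strictRank _ (rank n) ?_ ?_
  · intro a ha b hb
    have ha' : a < 2 + 2 * (n * n) + n := by simpa [refutation] using ha
    simp only [refutation, List.getElem_map, List.getElem_range] at hb
    rcases region_cases hn ha' with rfl | rfl | ⟨s, t, hs, ht, rfl⟩ | ⟨s, t, hs, ht, rfl⟩ | ⟨s, hs, rfl⟩
    · simp [line_zero, ResLine.premises, ResRule.premises] at hb
    · simp [line_one, ResLine.premises, ResRule.premises] at hb
    · simp [lineE_spec hs ht, ResLine.premises, ResRule.premises] at hb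
    · have hsnt := idxR_lt hs ht
      rw [lineR_spec hs ht] at hb
      simp only [ResLine.premises, ResRule.premises, List.mem_cons, List.not_mem_nil, or_false] at hb
      have hra : rank n (2 + n * n + (s * n + t)) = t + 1 := by simp [rank, lineR_spec hs ht, ResRule.pivot?]
      rw [hra]
      rcases hb with rfl | rfl
      · rcases Nat.eq_zero_or_pos t with rfl | htpos
        · simp [rank, line_one, ResRule.pivot?]
        · rw [if_neg (by omega)]
          obtain ⟨t', rfl⟩ : ∃ t', t = t' + 1 := ⟨t - 1, by omega⟩
          have e : 2 + n * n + (s * n + (t' + 1)) - 1 = 2 + n * n + (s * n + t') := by omega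
          rw [e]
          simp [rank, lineR_spec hs (show t' < n by omega), ResRule.pivot?]
      · simp [rank, lineE_spec hs ht, ResRule.pivot?]
    · rw [lineT_spec s] at hb
      simp only [ResLine.premises, ResRule.premises, List.mem_cons, List.not_mem_nil, or_false] at hb
      have hra : rank n (2 + 2 * (n * n) + s) = n + s + 1 := by simp [rank, lineT_spec s, ResRule.pivot?]
      rw [hra]
      rcases hb with rfl | rfl
      · rcases Nat.eq_zero_or_pos s with rfl | hspos
        · simp [rank, line_zero, ResRule.pivot?]
        · rw [if_neg (by omega)]
          have e : 2 + 2 * (n * n) + s - 1 = 2 + 2 * (n * n) + (s - 1) := by omega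
          rw [e]
          simp [rank, lineT_spec (s - 1), ResRule.pivot?]
          omega
      · simp [rank, lineR_spec hs (show n - 1 < n by omega), ResRule.pivot?]
        omega
  · intro a ha a' ha' v hv hv'
    simp only [refutation, List.getElem_map, List.getElem_range] at hv hv'
    simp [rank, hv, hv']

/-- **Core witness.** For the empty graph (`adj ≡ false`) on `n ≥ 1` vertices and any `k ≥ 2`,
`Clique(∅ₙ, k)` has a REGULAR resolution refutation with `2n² + n + 2` lines. -/
theorem exists_short_regular_refutation {k : ℕ} (hn : 1 ≤ n) (hk : 2 ≤ k) :
    ∃ π : List (ResLine ℕ), IsResRefutation (cliqueCNF n k fun _ _ => false) π ∧ IsRegular π ∧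
      π.length = 2 + 2 * (n * n) + n :=
  ⟨refutation n, refutation_isResRefutation hn hk, refutation_isRegular hn, length_refutation n⟩

end validity


/-! ## Load-bearing analysis: each one-sided version of the crux is FALSE -/

/-- The crux restated through `cliqueCNF` (definitionally the route decl, see
`regularResolutionRung_iff_restated`). -/
def Restated : Prop :=
  ∃ ε : ℝ, 0 < ε ∧ ∃ n₀ : ℕ, ∀ n ≥ n₀, ∀ (G : SimpleGraph (Fin n)) [DecidableRel G.Adj],
    ∀ π₁ π₂ : List (ResLine ℕ),
      IsResRefutation (cliqueCNF n (Nat.clog 2 (n ^ 2)) fun u v => decide (G.Adj u v)) π₁ → IsRegular π₁ →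
      IsResRefutation (cliqueCNF n (Nat.clog 2 (n ^ 2)) fun u v => decide (Gᶜ.Adj u v)) π₂ → IsRegular π₂ →
      (n : ℝ) ^ (ε * Real.logb 2 n) ≤ max (π₁.length : ℝ) (π₂.length : ℝ)

/-- The route decl is definitionally `Restated`. -/
theorem regularResolutionRung_iff_restated :
    Summit.PneNP.PneNP.Theses.RamseyUncertifiable.RegularResolutionRung ↔ Restated := Iff.rfl

/-- **The shape of a refutation of the crux** (pure logic): a kill needs, for every `ε > 0` beyond
every `n₀`, a graph with SHORT regular refutations on BOTH sides simultaneously — necessarily a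
`⌈2log₂ n⌉`-Ramsey graph (otherwise one of the two formulas is satisfiable and has no refutation). -/
theorem not_restated_iff :
    ¬ Restated ↔ ∀ ε : ℝ, 0 < ε → ∀ n₀ : ℕ, ∃ n ≥ n₀, ∃ (G : SimpleGraph (Fin n)) (_ : DecidableRel G.Adj),
      ∃ π₁ π₂ : List (ResLine ℕ),
        IsResRefutation (cliqueCNF n (Nat.clog 2 (n ^ 2)) fun u v => decide (G.Adj u v)) π₁ ∧ IsRegular π₁ ∧
        IsResRefutation (cliqueCNF n (Nat.clog 2 (n ^ 2)) fun u v => decide (Gᶜ.Adj u v)) π₂ ∧ IsRegular π₂ ∧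
        max (π₁.length : ℝ) (π₂.length : ℝ) < (n : ℝ) ^ (ε * Real.logb 2 n) := by
  unfold Restated
  push Not
  rfl

/-- `RegularResolutionRung` with the hypothesis on the COMPLEMENT side dropped (no `π₂`):
"every regular refutation of `Clique(G, ⌈2log₂ n⌉)` alone is quasi-polynomially long". -/
def RegularResolutionRungWithoutComplement : Prop :=
  ∃ ε : ℝ, 0 < ε ∧ ∃ n₀ : ℕ, ∀ n ≥ n₀, ∀ (G : SimpleGraph (Fin n)) [DecidableRel G.Adj],
    ∀ π₁ : List (ResLine ℕ),
      IsResRefutation (cliqueCNF n (Nat.clog 2 (n ^ 2)) fun u v => decide (G.Adj u v)) π₁ → IsRegular π₁ →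
      (n : ℝ) ^ (ε * Real.logb 2 n) ≤ (π₁.length : ℝ)

/-- `RegularResolutionRung` with the hypothesis on the GRAPH side dropped (no `π₁`). -/
def RegularResolutionRungWithoutGraph : Prop :=
  ∃ ε : ℝ, 0 < ε ∧ ∃ n₀ : ℕ, ∀ n ≥ n₀, ∀ (G : SimpleGraph (Fin n)) [DecidableRel G.Adj],
    ∀ π₂ : List (ResLine ℕ),
      IsResRefutation (cliqueCNF n (Nat.clog 2 (n ^ 2)) fun u v => decide (Gᶜ.Adj u v)) π₂ → IsRegular π₂ →
      (n : ℝ) ^ (ε * Real.logb 2 n) ≤ (π₂.length : ℝ)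

/-- Both one-sided versions are strengthenings of the crux (stated on `Restated`, which is the
crux by `regularResolutionRung_iff_restated`). -/
theorem restated_of_withoutComplement (h : RegularResolutionRungWithoutComplement) : Restated := by
  obtain ⟨ε, hε, n₀, h⟩ := h
  exact ⟨ε, hε, n₀, fun n hn G _ π₁ π₂ h₁ r₁ _ _ => (h n hn G π₁ h₁ r₁).trans (le_max_left _ _)⟩

/-- The graph-side-dropped version is a strengthening of the crux (`Restated`). -/
theorem restated_of_withoutGraph (h : RegularResolutionRungWithoutGraph) : Restated := by
  obtain ⟨ε, hε, n₀, h⟩ := h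
  exact ⟨ε, hε, n₀, fun n hn G _ π₁ π₂ _ _ h₂ r₂ => (h n hn G π₂ h₂ r₂).trans (le_max_right _ _)⟩

/-- Arithmetic of the witness: at `n = 2^m` the refutation length `2n² + n + 2` is eventually below
`n^{ε log₂ n} = 2^{ε m²}`. -/
theorem key_bound {ε : ℝ} (hε : 0 < ε) (n₀ : ℕ) :
    ∃ n : ℕ, n₀ ≤ n ∧ 1 ≤ n ∧ 2 ≤ Nat.clog 2 (n ^ 2) ∧
      ((2 + 2 * (n * n) + n : ℕ) : ℝ) < (n : ℝ) ^ (ε * Real.logb 2 n) := by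
  obtain ⟨m, hm₀, hm3, hmε⟩ : ∃ m : ℕ, n₀ ≤ m ∧ 3 ≤ m ∧ 3 ≤ ε * m := by
    refine ⟨n₀ + 3 + ⌈3 / ε⌉₊, by omega, by omega, ?_⟩
    have h1 : 3 / ε ≤ (⌈3 / ε⌉₊ : ℝ) := Nat.le_ceil _
    have h2 : (⌈3 / ε⌉₊ : ℝ) ≤ ((n₀ + 3 + ⌈3 / ε⌉₊ : ℕ) : ℝ) := by
      push_cast
      linarith [(Nat.cast_nonneg n₀ : (0 : ℝ) ≤ n₀)]
    have h3 : 3 / ε ≤ ((n₀ + 3 + ⌈3 / ε⌉₊ : ℕ) : ℝ) := h1.trans h2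
    rw [div_le_iff₀ hε] at h3
    linarith
  refine ⟨2 ^ m, hm₀.trans Nat.lt_two_pow_self.le, Nat.one_le_two_pow, ?_, ?_⟩
  · rw [← pow_mul, Nat.clog_pow _ _ (by norm_num)]
    omega
  · have hnR : ((2 ^ m : ℕ) : ℝ) = (2 : ℝ) ^ (m : ℝ) := by
      rw [Real.rpow_natCast]; push_cast; ring
    have hlog : Real.logb 2 ((2 ^ m : ℕ) : ℝ) = m := by
      rw [hnR, Real.logb_rpow (by norm_num) (by norm_num)]
    rw [hlog, hnR, ← Real.rpow_mul (by norm_num)]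
    have hexp : ((3 * m : ℕ) : ℝ) ≤ (m : ℝ) * (ε * m) := by
      push_cast
      have hm0 : (0 : ℝ) ≤ m := Nat.cast_nonneg m
      nlinarith
    have h8 : (2 : ℝ) ^ (3 * m) ≤ (2 : ℝ) ^ ((m : ℝ) * (ε * m)) := by
      rw [← Real.rpow_natCast]
      exact Real.rpow_le_rpow_of_exponent_le (by norm_num) hexp
    have hx : (8 : ℝ) ≤ (2 : ℝ) ^ m := by
      calc (8 : ℝ) = 2 ^ 3 := by norm_num
        _ ≤ 2 ^ m := pow_le_pow_right₀ (by norm_num) hm3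
    have hpoly : (2 : ℝ) + 2 * (2 ^ m * 2 ^ m) + 2 ^ m < (2 : ℝ) ^ (3 * m) := by
      have e : (2 : ℝ) ^ (3 * m) = 2 ^ m * (2 ^ m * 2 ^ m) := by ring
      rw [e]
      nlinarith [hx, mul_le_mul_of_nonneg_right hx (by positivity : (0 : ℝ) ≤ 2 ^ m * 2 ^ m),
        mul_le_mul_of_nonneg_left hx (by positivity : (0 : ℝ) ≤ 2 ^ m)]
    calc ((2 + 2 * (2 ^ m * 2 ^ m) + 2 ^ m : ℕ) : ℝ) = (2 : ℝ) + 2 * (2 ^ m * 2 ^ m) + 2 ^ m := by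
          push_cast; ring
      _ < (2 : ℝ) ^ (3 * m) := hpoly
      _ ≤ _ := h8

/-- **Load-bearing: the complement side.** Dropping `π₂` makes the crux FALSE: for the EMPTY graph
`G = ⊥` on `n = 2^m` vertices, `Clique(G, k)` has a regular refutation with `2n² + n + 2` lines
(blocks 0 and 1 cannot both be placed), far below `n^{ε log₂ n}`. Any proof of the crux must use
that `Ḡ` is also `k`-clique-free, i.e. that `G` is genuinely Ramsey. -/
theorem regularResolutionRung_false_without_complement : ¬ RegularResolutionRungWithoutComplement := by
  rintro ⟨ε, hε, n₀, h⟩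
  obtain ⟨n, hn₀, hn1, hk, hlt⟩ := key_bound hε n₀
  obtain ⟨π, hπ, hreg, hlen⟩ := exists_short_regular_refutation (n := n) hn1 hk
  have hle := h n hn₀ ⊥ π (by convert hπ using 2; funext u v; simp) hreg
  rw [hlen] at hle
  exact absurd (hle.trans_lt hlt) (lt_irrefl _)

/-- **Load-bearing: the graph side.** Symmetrically, dropping `π₁` makes the crux FALSE: take the
COMPLETE graph `G = ⊤`, whose complement is empty. -/
theorem regularResolutionRung_false_without_graph : ¬ RegularResolutionRungWithoutGraph := by
  rintro ⟨ε, hε, n₀, h⟩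
  obtain ⟨n, hn₀, hn1, hk, hlt⟩ := key_bound hε n₀
  obtain ⟨π, hπ, hreg, hlen⟩ := exists_short_regular_refutation (n := n) hn1 hk
  have hle := h n hn₀ ⊤ π (by convert hπ using 2; funext u v; simp) hreg
  rw [hlen] at hle
  exact absurd (hle.trans_lt hlt) (lt_irrefl _)

/-- For every `n ≥ 1` BOTH escape routes are realised — but by DIFFERENT graphs (`⊥` for the graph
side, `⊤` for the complement side); by Ramsey's theorem no graph on `n ≥ R(k,k)`… rather, no graph
has both `G` and `Ḡ` bipartite-trivially refutable: the `max` in the crux is exactly where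
Ramsey-ness enters. -/
theorem both_sides_separately_short {n : ℕ} (hn : 1 ≤ n) {k : ℕ} (hk : 2 ≤ k) :
    (∃ π, IsResRefutation (cliqueCNF n k fun u v => decide ((⊥ : SimpleGraph (Fin n)).Adj u v)) π ∧
        IsRegular π ∧ π.length = 2 + 2 * (n * n) + n) ∧
    (∃ π, IsResRefutation (cliqueCNF n k fun u v => decide ((⊤ : SimpleGraph (Fin n))ᶜ.Adj u v)) π ∧
        IsRegular π ∧ π.length = 2 + 2 * (n * n) + n) := by
  obtain ⟨π, hπ, hreg, hlen⟩ := exists_short_regular_refutation (n := n) (k := k) hn hk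
  refine ⟨⟨π, ?_, hreg, hlen⟩, ⟨π, ?_, hreg, hlen⟩⟩
  · convert hπ using 2; funext u v; simp
  · convert hπ using 2; funext u v; simp

end Summit.PneNP.PneNP.Theorems.RegularResolutionRung.Negative
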